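import Mathlib
import Summits.RiemannHypothesis.RiemannHypothesis.Theorems.WeilFarFloorMainTermExact
import Literature.NumberTheory.LFunctions.FordTheorem3RowLargeK
import HarnessLib

/-!
# The PNT floor to second order: `pntFloor a = e^a + 2a − 2 + (−2a² + 2a + 1)e^{−a} + O(a³e^{−2a})`

Helper file (`--supports stmt-RiemannHypothesis-0098`), pure proofs.  Seat rh-explicit-weil-1 gen10 (memo FORMAT-K3.md §11.18).
With `κ = ½ + δ` the root of `κ tanh κa = ½`, `x = 2aδ` and the fixed point `δ = (1+δ)e^{−a}e^{−x}` (`FloorGrowth.kappa_sub_half_eq`),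
the floor is EXACTLY `pntFloor a = 1/(δ(1+δ)) = e^a e^{x}/(1+δ)²`; expanding `e^x` to third order and `u = δe^a = (1+δ)e^{−x}` to second
order gives the `a²`-term: **`|pntFloor a − (e^a + 2a − 2) − (−2a² + 2a + 1)e^{−a}| ≤ 80·a³·e^{−2a}`** for `a ≥ 2`
(`abs_pntFloor_sub_second_le`; refines `FloorMainTerm.abs_pntFloor_sub_le`).  This is the cancellation behind the second-order term
`s(a) = (2 + 2γ − 2 log 2π)a·e^{−a} + …` of the floor law's cosh residual (memo §11.18).  Standard axioms only.
-/

set_option linter.dupNamespace false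
set_option autoImplicit false

noncomputable section

open Real

namespace Summit.RiemannHypothesis.RiemannHypothesis.Theorems.WeilFormatC

namespace FloorMainTerm

variable {a : ℝ}

/-- The polynomial remainder estimate for `core_arith2` (all quantities free reals). -/
theorem core_R_bound {a δ ε w P : ℝ} (ha : 2 ≤ a) (hδ0 : 0 < δ) (hε0 : 0 < ε)
    (hδhi : δ ≤ 1157 / 1000 * ε) (hδa1 : δ * a ≤ 314 / 1000) (hδ1 : δ ≤ 16 / 100)
    (hw1 : |w| ≤ 6 * a ^ 2 * δ ^ 2) (hP1 : |P| ≤ 16 / 9 * a ^ 3 * δ ^ 2 * (1 + δ))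
    (hδε : |δ - ε| ≤ 3 * a * ε ^ 2) (hc : |-2 * a ^ 2 + 2 * a + 1| ≤ 4 * a ^ 2)
    (hδ2 : δ ^ 2 ≤ 134 / 100 * ε ^ 2) :
    |(-2 * a ^ 2 + 2 * a + 1) * (δ - ε)
        + (2 * a * w + 2 * a ^ 2 * δ * (δ - 2 * δ * a + w) - 2 * w - δ * (δ - 2 * δ * a + w)
           - (-2 * a ^ 2 + 2 * a + 1) * ε * (2 * δ + δ ^ 2) - (2 * a - 2) * δ ^ 2) + P| ≤ 80 * a ^ 3 * ε ^ 2 := by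
  have ha0 : 0 < a := by linarith
  have hw2 := abs_le.1 hw1
  have hP2 := abs_le.1 hP1
  have hδε2 := abs_le.1 hδε
  have t1 : |(-2 * a ^ 2 + 2 * a + 1) * (δ - ε)| ≤ 12 * a ^ 3 * ε ^ 2 := by
    rw [abs_mul]
    calc |-2 * a ^ 2 + 2 * a + 1| * |δ - ε| ≤ 4 * a ^ 2 * (3 * a * ε ^ 2) :=
          mul_le_mul hc hδε (abs_nonneg _) (by positivity)
      _ = 12 * a ^ 3 * ε ^ 2 := by ring
  have t1' := abs_le.1 t1
  have haδ : a * δ ≤ 314 / 1000 := by linarith [hδa1]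
  have hδ2' : δ ^ 2 ≤ 134 / 100 * ε ^ 2 := hδ2
  have ha2 : 2 * a ^ 2 ≤ a ^ 3 := by nlinarith only [ha]
  have ha3pos : 0 < a ^ 3 := by positivity
  -- t2: |2 a w| ≤ 12 a³ δ²
  have t2 : |2 * a * w| ≤ 12 * a ^ 3 * δ ^ 2 := by
    rw [abs_le]; constructor <;> nlinarith only [hw2.1, hw2.2, ha0, ha2, mul_nonneg ha0.le (sq_nonneg δ)]
  -- t3: |2a²δ(δ − 2δa + w)| ≤ 9 a³ δ²
  have t3 : |2 * a ^ 2 * δ * (δ - 2 * δ * a + w)| ≤ 9 * a ^ 3 * δ ^ 2 := by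
    have i1 : |δ - 2 * δ * a + w| ≤ δ + 2 * δ * a + 6 * a ^ 2 * δ ^ 2 := by
      rw [abs_le]; constructor <;> nlinarith only [hw2.1, hw2.2, hδ0, ha0, mul_pos hδ0 ha0]
    rw [abs_mul, abs_of_nonneg (by positivity : (0:ℝ) ≤ 2 * a ^ 2 * δ)]
    have i2 : 2 * a ^ 2 * δ * (δ + 2 * δ * a + 6 * a ^ 2 * δ ^ 2) ≤ 9 * a ^ 3 * δ ^ 2 := by
      -- = 2a²δ² + 4a³δ² + 12 a⁴ δ³ ≤ a³δ² + 4a³δ² + 12·0.314 a³ δ²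
      nlinarith only [ha, ha2, haδ, hδ0, ha0, mul_pos hδ0 ha0, ha3pos, mul_nonneg ha3pos.le (sq_nonneg δ),
        mul_nonneg (mul_nonneg ha3pos.le (sq_nonneg δ)) (by linarith [haδ] : (0:ℝ) ≤ 314/1000 - a * δ)]
    calc 2 * a ^ 2 * δ * |δ - 2 * δ * a + w| ≤ 2 * a ^ 2 * δ * (δ + 2 * δ * a + 6 * a ^ 2 * δ ^ 2) :=
          mul_le_mul_of_nonneg_left i1 (by positivity)
      _ ≤ 9 * a ^ 3 * δ ^ 2 := i2
  -- t4: |2w| ≤ 6 a³ δ²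
  have t4 : |2 * w| ≤ 6 * a ^ 3 * δ ^ 2 := by
    rw [abs_le]; constructor <;> nlinarith only [hw2.1, hw2.2, ha2, mul_nonneg ha0.le (sq_nonneg δ), sq_nonneg δ]
  -- t5: |δ(δ − 2δa + w)| ≤ 2 a³ δ²
  have t5 : |δ * (δ - 2 * δ * a + w)| ≤ 2 * a ^ 3 * δ ^ 2 := by
    have i1 : |δ - 2 * δ * a + w| ≤ δ + 2 * δ * a + 6 * a ^ 2 * δ ^ 2 := by
      rw [abs_le]; constructor <;> nlinarith only [hw2.1, hw2.2, hδ0, ha0, mul_pos hδ0 ha0]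
    rw [abs_mul, abs_of_pos hδ0]
    have i2 : δ * (δ + 2 * δ * a + 6 * a ^ 2 * δ ^ 2) ≤ 2 * a ^ 3 * δ ^ 2 := by
      -- δ² (1 + 2a + 6a²δ) ≤ δ² (1 + 2a + a²) ≤ 2 a³ δ²  (a ≥ 2, δ ≤ 0.16)
      have j1 : 1 + 2 * a + 6 * a ^ 2 * δ ≤ 2 * a ^ 3 := by nlinarith only [ha, hδ1, sq_nonneg a, ha0]
      nlinarith only [j1, sq_nonneg δ]
    calc δ * |δ - 2 * δ * a + w| ≤ δ * (δ + 2 * δ * a + 6 * a ^ 2 * δ ^ 2) := mul_le_mul_of_nonneg_left i1 hδ0.le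
      _ ≤ 2 * a ^ 3 * δ ^ 2 := i2
  -- t6: |c ε (2δ + δ²)| ≤ 5 a³ ε²
  have t6 : |(-2 * a ^ 2 + 2 * a + 1) * ε * (2 * δ + δ ^ 2)| ≤ 5 * a ^ 3 * ε ^ 2 := by
    rw [abs_mul, abs_mul, abs_of_pos hε0, abs_of_pos (by positivity : (0:ℝ) < 2 * δ + δ ^ 2)]
    have i1 : 2 * δ + δ ^ 2 ≤ 5 / 2 * ε := by nlinarith only [hδhi, hδ1, hδ0]
    calc |-2 * a ^ 2 + 2 * a + 1| * ε * (2 * δ + δ ^ 2) ≤ 4 * a ^ 2 * ε * (5 / 2 * ε) := by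
          have := mul_le_mul hc (le_refl ε) hε0.le (by positivity)
          exact mul_le_mul this i1 (by positivity) (by positivity)
      _ = 10 * a ^ 2 * ε ^ 2 := by ring
      _ ≤ 5 * a ^ 3 * ε ^ 2 := by nlinarith only [ha2, sq_nonneg ε, mul_nonneg (sq_nonneg a) (sq_nonneg ε), mul_nonneg ha3pos.le (sq_nonneg ε), ha]
  -- t7: |(2a − 2) δ²| ≤ a³ δ²
  have t7 : |(2 * a - 2) * δ ^ 2| ≤ a ^ 3 * δ ^ 2 := by
    rw [abs_mul, abs_of_nonneg (by linarith : (0:ℝ) ≤ 2 * a - 2), abs_of_nonneg (sq_nonneg δ)]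
    nlinarith only [ha, ha2, sq_nonneg δ, mul_nonneg ha0.le (sq_nonneg δ)]
  -- convert δ² to ε²
  have hconv : a ^ 3 * δ ^ 2 ≤ 134 / 100 * (a ^ 3 * ε ^ 2) := by nlinarith only [hδ2', ha3pos]
  have t2' := abs_le.1 t2; have t3' := abs_le.1 t3; have t4' := abs_le.1 t4; have t5' := abs_le.1 t5
  have t6' := abs_le.1 t6; have t7' := abs_le.1 t7
  rw [abs_le]; constructor <;> linarith [hP2.1, hP2.2, hconv, hδ1,
    mul_le_mul_of_nonneg_left (show δ ≤ 1 by linarith) (by positivity : (0:ℝ) ≤ 16 / 9 * a ^ 3 * δ ^ 2)]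


/-- Core arithmetic of `abs_pntFloor_sub_second_le` on free real variables (`E = 1/ε`, `u = δE`, `x = 2δa`). -/
theorem core_arith2 {a δ ε u w P L : ℝ} (ha : 2 ≤ a) (hδ0 : 0 < δ) (hε0 : 0 < ε)
    (hδhi : δ ≤ 1157 / 1000 * ε) (haε : a * ε ≤ 271 / 1000)
    (hδε_hi : δ - ε ≤ 1157 / 1000 * ε ^ 2) (hδε_lo : -(2314 / 1000) * a * ε ^ 2 ≤ δ - ε)
    (hu : u = 1 + δ - 2 * δ * a + w) (hδE : δ / ε = u) (hu_lo : 0 < u) (hu_hi : u ≤ 1 + δ)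
    (hw_lo : -(δ * (2 * δ * a)) ≤ w) (hw_hi : w ≤ -(δ * (2 * δ * a)) + (1 + δ) * (2 * δ * a) ^ 2)
    (hP : |P| ≤ 4 / 9 * a * (2 * δ * a) ^ 2 * u)
    (key : L * (1 + δ) ^ 2 = 1 / ε + 2 * a * u + 2 * a ^ 2 * δ * u + P) :
    |L - (1 / ε + 2 * a - 2 + (-2 * a ^ 2 + 2 * a + 1) * ε)| ≤ 80 * a ^ 3 * ε ^ 2 := by
  have ha0 : 0 < a := by linarith
  have haε3 : a * ε ≤ 271 / 1000 := haε
  have hδa : δ * a ≤ 1157 / 1000 * (a * ε) := by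
    have := mul_le_mul_of_nonneg_right hδhi ha0.le; linarith
  have hδa1 : δ * a ≤ 314 / 1000 := by linarith [hδa, haε3]
  have hε1 : ε ≤ 1355 / 10000 := by nlinarith only [ha, haε3, hε0]
  have hδ1 : δ ≤ 16 / 100 := by linarith [hδhi, hε1]
  -- |w| ≤ 2 a δ² + 4 (1+δ) a² δ² ≤ 6 a² δ²
  have hw1 : |w| ≤ 6 * a ^ 2 * δ ^ 2 := by
    have k1 : δ * (2 * δ * a) ≤ a ^ 2 * δ ^ 2 := by nlinarith only [ha, sq_nonneg δ, mul_nonneg ha0.le (sq_nonneg δ)]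
    have k2 : (1 + δ) * (2 * δ * a) ^ 2 ≤ 5 * a ^ 2 * δ ^ 2 := by
      have : (1 + δ) * (2 * δ * a) ^ 2 = 4 * (1 + δ) * (a ^ 2 * δ ^ 2) := by ring
      rw [this]; nlinarith only [hδ1, mul_nonneg (sq_nonneg a) (sq_nonneg δ)]
    have k0 : 0 ≤ δ * (2 * δ * a) := by positivity
    rw [abs_le]; constructor <;> linarith [hw_lo, hw_hi, k0, k1, k2, mul_nonneg (sq_nonneg a) (sq_nonneg δ)]
  have hP1 : |P| ≤ 16 / 9 * a ^ 3 * δ ^ 2 * (1 + δ) := by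
    calc |P| ≤ 4 / 9 * a * (2 * δ * a) ^ 2 * u := hP
      _ = 16 / 9 * a ^ 3 * δ ^ 2 * u := by ring
      _ ≤ 16 / 9 * a ^ 3 * δ ^ 2 * (1 + δ) := by
          have : 0 ≤ 16 / 9 * a ^ 3 * δ ^ 2 := by positivity
          exact mul_le_mul_of_nonneg_left hu_hi this
  -- |δ − ε| ≤ 3 a ε²
  have hδε : |δ - ε| ≤ 3 * a * ε ^ 2 := by
    have k1 : 0 ≤ (3 * a - 6) * ε ^ 2 := mul_nonneg (by linarith) (sq_nonneg ε)
    have k2 : 0 ≤ a * ε ^ 2 := mul_nonneg ha0.le (sq_nonneg ε)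
    rw [abs_le]; constructor <;> linarith only [k1, k2, hδε_lo, hδε_hi]
  -- bound each piece; write everything ≤ K a³ ε²
  have hc : |-2 * a ^ 2 + 2 * a + 1| ≤ 4 * a ^ 2 := by
    rw [abs_le]; constructor <;> nlinarith only [ha]
  have hδ2 : δ ^ 2 ≤ 134 / 100 * ε ^ 2 := by nlinarith only [hδhi, hδ0, hε0]
  have hsq1 : 1 ≤ (1 + δ) ^ 2 := by nlinarith only [hδ0]
  -- main estimate on the RHS (separate lemma, own heartbeat budget)
  have hR := core_R_bound ha hδ0 hε0 hδhi hδa1 hδ1 hw1 hP1 hδε hc hδ2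
  -- the identity
  have h1ε : 1 / ε = u / δ := by
    rw [← hδE]; field_simp
  have hexp : (L - (1 / ε + 2 * a - 2 + (-2 * a ^ 2 + 2 * a + 1) * ε)) * (1 + δ) ^ 2
      = (-2 * a ^ 2 + 2 * a + 1) * (δ - ε)
        + (2 * a * w + 2 * a ^ 2 * δ * (δ - 2 * δ * a + w) - 2 * w - δ * (δ - 2 * δ * a + w)
           - (-2 * a ^ 2 + 2 * a + 1) * ε * (2 * δ + δ ^ 2) - (2 * a - 2) * δ ^ 2) + P := by
    have hδne : δ ≠ 0 := hδ0.ne'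
    have e1 : (1 / ε) * (1 + δ) ^ 2 = 1 / ε + 2 * u + δ * u := by
      rw [h1ε]; field_simp; ring
    have e2 : (L - (1 / ε + 2 * a - 2 + (-2 * a ^ 2 + 2 * a + 1) * ε)) * (1 + δ) ^ 2
        = L * (1 + δ) ^ 2 - (1 / ε) * (1 + δ) ^ 2 - (2 * a - 2 + (-2 * a ^ 2 + 2 * a + 1) * ε) * (1 + δ) ^ 2 := by ring
    rw [e2, key, e1, hu]; ring
  -- conclude: |L − M| ≤ |L − M| (1+δ)² = |RHS| ≤ 60 a³ ε²
  have hfin : |L - (1 / ε + 2 * a - 2 + (-2 * a ^ 2 + 2 * a + 1) * ε)| * (1 + δ) ^ 2 ≤ 80 * a ^ 3 * ε ^ 2 := by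
    have : |L - (1 / ε + 2 * a - 2 + (-2 * a ^ 2 + 2 * a + 1) * ε)| * (1 + δ) ^ 2
        = |(L - (1 / ε + 2 * a - 2 + (-2 * a ^ 2 + 2 * a + 1) * ε)) * (1 + δ) ^ 2| := by
      rw [abs_mul, abs_of_nonneg (by positivity : (0:ℝ) ≤ (1 + δ) ^ 2)]
    rw [this, hexp]; exact hR
  have habs := abs_nonneg (L - (1 / ε + 2 * a - 2 + (-2 * a ^ 2 + 2 * a + 1) * ε))
  nlinarith only [hfin, habs, hsq1, mul_nonneg habs (by linarith only [hsq1] : (0:ℝ) ≤ (1 + δ) ^ 2 - 1)]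



/-- Third-order Taylor bound: `|e^x − 1 − x − x²/2| ≤ (2/9)|x|³` for `|x| ≤ 1` (Mathlib `Real.exp_bound`, `n = 3`). -/
theorem abs_exp_sub_quad_le {x : ℝ} (hx : |x| ≤ 1) : |Real.exp x - 1 - x - x ^ 2 / 2| ≤ 2 / 9 * |x| ^ 3 := by
  have h := Real.exp_bound hx (show 0 < 3 by norm_num)
  have hs : (∑ m ∈ Finset.range 3, x ^ m / (m.factorial : ℝ)) = 1 + x + x ^ 2 / 2 := by
    simp [Finset.sum_range_succ, Nat.factorial]
  rw [hs] at h
  have h4 : ((Nat.succ 3 : ℕ) : ℝ) / ((Nat.factorial 3 : ℕ) * (3 : ℕ) : ℝ) = 2 / 9 := by norm_num [Nat.factorial]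
  rw [h4] at h
  have : Real.exp x - 1 - x - x ^ 2 / 2 = Real.exp x - (1 + x + x ^ 2 / 2) := by ring
  rw [this]; linarith

/-- **The PNT floor to second order**: `|pntFloor a − (e^a + 2a − 2) − (−2a² + 2a + 1)e^{−a}| ≤ 80·a³·e^{−2a}` for `a ≥ 2`. -/
theorem abs_pntFloor_sub_second_le (ha : 2 ≤ a) :
    |pntFloor a - (Real.exp a + 2 * a - 2) - (-2 * a ^ 2 + 2 * a + 1) * Real.exp (-a)|
      ≤ 80 * a ^ 3 * Real.exp (-a) ^ 2 := by
  obtain ⟨hκ, heig⟩ := FloorGrowth.sInf_pntKappaSet_spec (by linarith : 0 < a)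
  unfold pntFloor pntKappa
  set κ := sInf {κ : ℝ | 1 / 2 < κ ∧ 1 / 2 ≤ κ * Real.tanh (κ * a)} with hκdef
  have hfix := FloorGrowth.kappa_sub_half_eq heig
  set δ := κ - 1 / 2 with hδdef
  have hδ0 : 0 < δ := by rw [hδdef]; linarith
  have hk : κ + 1 / 2 = 1 + δ := by rw [hδdef]; ring
  rw [hk] at hfix
  obtain ⟨-, haε⟩ := exp_neg_bounds ha
  have hsplit : Real.exp (-(2 * (κ * a))) = Real.exp (-a) * Real.exp (-(2 * δ * a)) := by
    rw [← Real.exp_add]; congr 1; rw [hδdef]; ring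
  rw [hsplit] at hfix
  -- hfix : δ = (1 + δ) * (e^{−a} * e^{−x}),  x = 2δa
  have hEε : Real.exp a * Real.exp (-a) = 1 := by rw [← Real.exp_add, add_neg_cancel, Real.exp_zero]
  have hE : 0 < Real.exp a := Real.exp_pos a
  have hε : 0 < Real.exp (-a) := Real.exp_pos (-a)
  have ha0 : (0 : ℝ) ≤ a := by linarith
  have hx0 : 0 ≤ 2 * δ * a := by positivity
  have hex1 : Real.exp (-(2 * δ * a)) ≤ 1 := Real.exp_le_one_iff.2 (by linarith)
  -- δ ≤ 1.157 e^{−a}, and δ − ε bounds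
  have hδle : δ ≤ (1 + δ) * Real.exp (-a) := by
    have h2 := mul_le_mul_of_nonneg_left (mul_le_mul_of_nonneg_left hex1 hε.le) (by linarith : (0 : ℝ) ≤ 1 + δ)
    rw [mul_one, ← hfix] at h2; exact h2
  have hε1 : Real.exp (-a) ≤ 1355 / 10000 := by nlinarith only [ha, haε, hε]
  have hδ : δ ≤ 1157 / 1000 * Real.exp (-a) := by nlinarith only [hδle, hε1, hε, hδ0]
  have hδε_hi : δ - Real.exp (-a) ≤ 1157 / 1000 * Real.exp (-a) ^ 2 := by nlinarith only [hδle, hδ, hε, hδ0]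
  have hxle : 2 * δ * a ≤ 1 := by
    have h1 : δ * a ≤ 1157 / 1000 * (a * Real.exp (-a)) := by nlinarith only [mul_le_mul_of_nonneg_right hδ ha0]
    nlinarith only [h1, haε]
  have hexlo : 1 - 2 * δ * a ≤ Real.exp (-(2 * δ * a)) := Real.one_sub_le_exp_neg _
  have hexhi : Real.exp (-(2 * δ * a)) ≤ 1 - 2 * δ * a + (2 * δ * a) ^ 2 := Literature.NumberTheory.LFunctions.FordL36.exp_neg_le_one_sub_add_sq hx0
  have hδε_lo : -(2314 / 1000) * a * Real.exp (-a) ^ 2 ≤ δ - Real.exp (-a) := by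
    have h3 : (1 + δ) * (Real.exp (-a) * (1 - 2 * δ * a)) ≤ (1 + δ) * (Real.exp (-a) * Real.exp (-(2 * δ * a))) :=
      mul_le_mul_of_nonneg_left (mul_le_mul_of_nonneg_left hexlo hε.le) (by linarith)
    rw [← hfix] at h3
    have h4 : Real.exp (-a) * (1 - 2 * δ * a) ≤ (1 + δ) * (Real.exp (-a) * (1 - 2 * δ * a)) := by
      have : 0 ≤ Real.exp (-a) * (1 - 2 * δ * a) := mul_nonneg hε.le (by linarith)
      nlinarith only [this, hδ0]
    nlinarith only [h3, h4, hδ, hε, hδ0, ha0, mul_nonneg ha0 hε.le]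
  -- u = δ e^a = (1+δ) e^{−x}
  have hu : δ * Real.exp a = (1 + δ) * Real.exp (-(2 * δ * a)) := by
    have h1 : δ * Real.exp a = (1 + δ) * (Real.exp (-a) * Real.exp (-(2 * δ * a))) * Real.exp a := by rw [← hfix]
    rw [h1]
    calc (1 + δ) * (Real.exp (-a) * Real.exp (-(2 * δ * a))) * Real.exp a
        = (1 + δ) * Real.exp (-(2 * δ * a)) * (Real.exp a * Real.exp (-a)) := by ring
      _ = (1 + δ) * Real.exp (-(2 * δ * a)) := by rw [hEε, mul_one]
  have hu_lo : 0 < δ * Real.exp a := mul_pos hδ0 hE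
  have hu_hi : δ * Real.exp a ≤ 1 + δ := by
    rw [hu]; nlinarith only [hex1, hδ0]
  have hδE : δ / Real.exp (-a) = δ * Real.exp a := by
    rw [div_eq_iff hε.ne']; rw [mul_assoc, hEε, mul_one]
  -- w and its bounds
  set w := δ * Real.exp a - (1 + δ - 2 * δ * a) with hwdef
  have huw : δ * Real.exp a = 1 + δ - 2 * δ * a + w := by rw [hwdef]; ring
  have hw_lo : -(δ * (2 * δ * a)) ≤ w := by
    rw [hwdef, hu]; nlinarith only [mul_le_mul_of_nonneg_left hexlo (by linarith : (0:ℝ) ≤ 1 + δ), hδ0]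
  have hw_hi : w ≤ -(δ * (2 * δ * a)) + (1 + δ) * (2 * δ * a) ^ 2 := by
    rw [hwdef, hu]; nlinarith only [mul_le_mul_of_nonneg_left hexhi (by linarith : (0:ℝ) ≤ 1 + δ), hδ0]
  -- Taylor remainder and the identity L(1+δ)² = e^a e^x
  have hρ := abs_exp_sub_quad_le (show |2 * δ * a| ≤ 1 by rwa [abs_of_nonneg hx0])
  rw [abs_of_nonneg hx0] at hρ
  set ρ := Real.exp (2 * δ * a) - 1 - 2 * δ * a - (2 * δ * a) ^ 2 / 2 with hρdef
  have hP : |Real.exp a * ρ| ≤ 4 / 9 * a * (2 * δ * a) ^ 2 * (δ * Real.exp a) := by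
    rw [abs_mul, abs_of_pos hE]
    have : 4 / 9 * a * (2 * δ * a) ^ 2 * (δ * Real.exp a) = Real.exp a * (2 / 9 * (2 * δ * a) ^ 3) := by ring
    rw [this]; exact mul_le_mul_of_nonneg_left hρ hE.le
  have hux : δ * Real.exp a * Real.exp (2 * δ * a) = 1 + δ := by
    rw [hu, mul_assoc, ← Real.exp_add, neg_add_cancel, Real.exp_zero, mul_one]
  have hk2 : κ ^ 2 - 1 / 4 = δ * (1 + δ) := by rw [hδdef]; ring
  have hL : 1 / (κ ^ 2 - 1 / 4) * (1 + δ) ^ 2 = Real.exp a * Real.exp (2 * δ * a) := by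
    rw [hk2]
    have hδ1 : (1 + δ) ≠ 0 := by positivity
    have hδne : δ ≠ 0 := hδ0.ne'
    have h2 : Real.exp a * Real.exp (2 * δ * a) = (1 + δ) / δ := by
      rw [eq_div_iff hδne]; linarith [hux]
    rw [h2]; field_simp
  have key : 1 / (κ ^ 2 - 1 / 4) * (1 + δ) ^ 2
      = 1 / Real.exp (-a) + 2 * a * (δ * Real.exp a) + 2 * a ^ 2 * δ * (δ * Real.exp a) + Real.exp a * ρ := by
    have hinv : 1 / Real.exp (-a) = Real.exp a := by
      rw [div_eq_iff hε.ne', hEε]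
    rw [hL, hinv, hρdef]; ring
  have hmain := core_arith2 ha hδ0 hε hδ haε hδε_hi hδε_lo huw hδE hu_lo hu_hi hw_lo hw_hi hP key
  have hinv : 1 / Real.exp (-a) = Real.exp a := by rw [div_eq_iff hε.ne', hEε]
  rw [hinv] at hmain
  have hre : 1 / (κ ^ 2 - 1 / 4) - (Real.exp a + 2 * a - 2) - (-2 * a ^ 2 + 2 * a + 1) * Real.exp (-a)
      = 1 / (κ ^ 2 - 1 / 4) - (Real.exp a + 2 * a - 2 + (-2 * a ^ 2 + 2 * a + 1) * Real.exp (-a)) := by ring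
  rw [hre]; exact hmain

end FloorMainTerm

end Summit.RiemannHypothesis.RiemannHypothesis.Theorems.WeilFormatC
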